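import Mathlib

/-!
# Crux `MatrixDescartes` (stmt-ValiantsHypothesis-18050), line `rolle-schur-residual` —
# COMPRESSION LEMMA for the telescope stub `stub_telescope`: `wᵀ adj(F) w` is a nonzero constant
# times the determinant of an `(m − 1, K)` lacunary pencil with symmetric letters

Line file: `Summits/ValiantsHypothesis/ValiantsHypothesis/Cruxes/MatrixDescartes/Lines/rolle_schur_residual.lean`
(ideator val-idea-3).  Its telescope stub `stub_telescope : IncrementTelescope` (induction on `m`
along a direction `w`) needs the `m`-handle of the Rolle–Schur step in pencil form: the polynomial
`a = wᵀ adj(F) w` (the line's `compDet d S w`) must again be (a constant times) the determinant of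
a lacunary pencil of the SAME exponent vector `d` and size `m − 1`, with symmetric letters, so that
the increment law can be iterated.  This file proves exactly that (`compDet_eq_C_mul_det_pencil`):
for `F = ∑ₗ X^{dₗ} Sₗ` with real symmetric `(n+1) × (n+1)` letters and `w ≠ 0` there are a real
`c ≠ 0` and real symmetric `n × n` letters `S'ₗ` with `wᵀ adj(F) w = C c · det (∑ₗ X^{dₗ} S'ₗ)`.

**Proof.**  §1 `exists_frame`: a real invertible `T` with `T w = (w·w) e₀` (rows: `w`, then a
basis of the kernel of `v ↦ v·w`, rank–nullity).  §2 over `ℝ[X]` with `T' = C(T)`: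
`G = T' F T'ᵀ = ∑ₗ X^{dₗ} C(T Sₗ Tᵀ)` (congruence), `adj G = adj(T')ᵀ · adj F · adj T'`
(`Matrix.adjugate_mul_distrib`, `adjugate_transpose`), the `(0,0)` entry of `adj G` is the `(0,0)`
minor `det (∑ₗ X^{dₗ} C(S'ₗ))`, `S'ₗ = T Sₗ Tᵀ` minus first row and column
(`Matrix.adjugate_fin_succ_eq_det_submatrix`), and `adj(T')·(T' w) = det T' • w` gives
`det T' • w = C μ • col₀(adj T')`; hence `(det T)² · wᵀ adj(F) w = μ² · det (∑ₗ X^{dₗ} C(S'ₗ))`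
(`det_sq_mul_compDet_eq`) and `c = μ²/(det T)²`, `μ = w·w`.  Symmetry of `S'ₗ` is automatic
(`(T S Tᵀ)ᵀ = T S Tᵀ`).  In an orthonormal frame this is the classical `wᵀ adj(F) w =
‖w‖² det F|_{w^⊥}` (Schur complement / bordered determinant), cf.
[corpus:book:horn2012-matrix-analysis p 735] cited by the card; the frame-free form above avoids
Gram–Schmidt.  Elementary; Mathlib only; axioms `propext`, `Classical.choice`, `Quot.sound`.

Honest framing: a reusable algebraic tool for the line's M-sized SUPPORT stub `stub_telescope`
(landed separately); instrument/structure tier.  The line's law (`stub_residualLaw`, XL) is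
untouched; the crux `LacunarySymmetroid.MatrixDescartes`, Conjecture B (`KPlusLogSqLaw`) and rung V1
do NOT move; `VP ≠ VNP` is NOT proved and nothing here is progress on it.  No definitions, no named
facts.
-/

-- `Summit.ValiantsHypothesis.ValiantsHypothesis.…` is the tree's mandated single-conjunct layout
-- (Sub = Summit), so the duplicated namespace component is intended.
set_option linter.dupNamespace false
set_option autoImplicit false

namespace Summit.ValiantsHypothesis.ValiantsHypothesis.Theorems.LacunarySymmetroidMatrixDescartes

open Polynomial Matrix Finset
open scoped BigOperators

namespace RolleSchur

/-! ## §1 A frame adapted to a nonzero vector -/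

/-- For a nonzero `w : Fin (n+1) → ℝ` there is an invertible real matrix `T` with
`T w = (w·w) e₀`: first row `w`, the other rows a basis of the hyperplane `w^⊥`. [folklore] -/
theorem exists_frame {n : ℕ} (w : Fin (n + 1) → ℝ) (hw : w ≠ 0) :
    ∃ T : Matrix (Fin (n + 1)) (Fin (n + 1)) ℝ,
      T.det ≠ 0 ∧ T *ᵥ w = (w ⬝ᵥ w) • (Pi.single 0 1 : Fin (n + 1) → ℝ) := by
  -- the linear form `v ↦ v · w`
  let φ : (Fin (n + 1) → ℝ) →ₗ[ℝ] ℝ :=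
    { toFun := fun v => v ⬝ᵥ w
      map_add' := fun u v => add_dotProduct u v w
      map_smul' := fun c v => smul_dotProduct c v w }
  have hφ : ∀ v, φ v = v ⬝ᵥ w := fun v => rfl
  have hww : w ⬝ᵥ w ≠ 0 := fun h => hw (dotProduct_self_eq_zero.mp h)
  -- `φ` is onto, so its kernel has dimension `n`
  have hrange : LinearMap.range φ = ⊤ := by
    refine LinearMap.range_eq_top.mpr fun r => ⟨(r / (w ⬝ᵥ w)) • w, ?_⟩
    rw [hφ, smul_dotProduct, smul_eq_mul, div_mul_cancel₀ r hww]
  have hker : Module.finrank ℝ (LinearMap.ker φ) = n := by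
    have h := LinearMap.finrank_range_add_finrank_ker φ
    rw [hrange, finrank_top, Module.finrank_self, Module.finrank_fin_fun] at h
    omega
  let b := Module.finBasisOfFinrankEq ℝ (LinearMap.ker φ) hker
  -- rows of the frame: `w`, then the kernel basis
  let rows : Fin (n + 1) → (Fin (n + 1) → ℝ) :=
    Fin.cons w (fun i => ((b i : LinearMap.ker φ) : Fin (n + 1) → ℝ))
  refine ⟨Matrix.of rows, ?_, ?_⟩
  · -- invertible: the rows are linearly independent
    have hli : LinearIndependent ℝ rows := by
      refine linearIndependent_finCons.mpr ⟨?_, ?_⟩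
      · exact b.linearIndependent.map' (LinearMap.ker φ).subtype (Submodule.ker_subtype _)
      · intro hmem
        have hsub : Submodule.span ℝ
            (Set.range fun i => ((b i : LinearMap.ker φ) : Fin (n + 1) → ℝ)) ≤ LinearMap.ker φ := by
          refine Submodule.span_le.mpr ?_
          rintro _ ⟨i, rfl⟩
          exact (b i).2
        have hw0 : φ w = 0 := LinearMap.mem_ker.mp (hsub hmem)
        exact hww (by rwa [hφ] at hw0)
    have hunit : IsUnit (Matrix.of rows) := Matrix.linearIndependent_rows_iff_isUnit.mp hli
    exact ((Matrix.isUnit_iff_isUnit_det _).mp hunit).ne_zero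
  · -- `T w = (w·w) e₀`
    funext i
    refine Fin.cases ?_ (fun j => ?_) i
    · simp [Matrix.mulVec, rows]
    · have h0 : φ (b j) = 0 := LinearMap.mem_ker.mp (b j).2
      rw [hφ] at h0
      simp [Matrix.mulVec, rows, h0]

/-! ## §2 Congruence and the `(0,0)` adjugate entry -/

/-- Congruence of a lacunary pencil by a constant matrix: `T F Tᵀ = ∑ₗ X^{dₗ} (T Sₗ Tᵀ)`. [folklore] -/
theorem frame_mul_pencil_mul_transpose {m K : ℕ} (d : Fin K → ℕ)
    (S : Fin K → Matrix (Fin m) (Fin m) ℝ) (T : Matrix (Fin m) (Fin m) ℝ) :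
    T.map C * (∑ l, (X : ℝ[X]) ^ d l • (S l).map C) * (T.map C)ᵀ =
      ∑ l, (X : ℝ[X]) ^ d l • (T * S l * Tᵀ).map C := by
  rw [Finset.mul_sum, Finset.sum_mul]
  refine Finset.sum_congr rfl fun l _ => ?_
  rw [Matrix.map_mul, Matrix.map_mul, Matrix.transpose_map, Matrix.mul_smul, Matrix.smul_mul]

/-- **Compression identity.**  If `T w = μ e₀` then, with `F = ∑ₗ X^{dₗ} Sₗ` and
`S'ₗ = (T Sₗ Tᵀ)` with the first row and column deleted,
`(det T)² · wᵀ adj(F) w = μ² · det (∑ₗ X^{dₗ} S'ₗ)`: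
`adj(T F Tᵀ) = adj(T)ᵀ adj(F) adj(T)`, its `(0,0)` entry is the `(0,0)` minor `det (∑ X^{dₗ} S'ₗ)`,
and the `0`-th column of `adj(T)` is `(det T / μ) · w`. [folklore] -/
theorem det_sq_mul_compDet_eq {n K : ℕ} (d : Fin K → ℕ)
    (S : Fin K → Matrix (Fin (n + 1)) (Fin (n + 1)) ℝ) (w : Fin (n + 1) → ℝ)
    (T : Matrix (Fin (n + 1)) (Fin (n + 1)) ℝ) (μ : ℝ)
    (hTw : T *ᵥ w = μ • (Pi.single 0 1 : Fin (n + 1) → ℝ)) :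
    C (T.det ^ 2) * ((fun i => C (w i)) ⬝ᵥ
        ((∑ l, (X : ℝ[X]) ^ d l • (S l).map C).adjugate *ᵥ fun i => C (w i))) =
      C (μ ^ 2) * (∑ l, (X : ℝ[X]) ^ d l •
        ((T * S l * Tᵀ).submatrix Fin.succ Fin.succ).map C).det := by
  set F : Matrix (Fin (n + 1)) (Fin (n + 1)) ℝ[X] := ∑ l, (X : ℝ[X]) ^ d l • (S l).map C with hF
  set T' : Matrix (Fin (n + 1)) (Fin (n + 1)) ℝ[X] := T.map C with hT'
  set w' : Fin (n + 1) → ℝ[X] := fun i => C (w i) with hw'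
  set G : Matrix (Fin (n + 1)) (Fin (n + 1)) ℝ[X] := T' * F * T'ᵀ with hG
  -- the compressed pencil is the `(0,0)` minor of `G`
  have hGsub : G.submatrix Fin.succ Fin.succ =
      ∑ l, (X : ℝ[X]) ^ d l • ((T * S l * Tᵀ).submatrix Fin.succ Fin.succ).map C := by
    rw [hG, hT', hF, frame_mul_pencil_mul_transpose]
    refine Matrix.ext fun i j => ?_
    simp only [Matrix.submatrix_apply, Matrix.sum_apply, Matrix.smul_apply, Matrix.map_apply, smul_eq_mul]
  -- `adj(G) 0 0` is the determinant of that minor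
  have hadj00 : G.adjugate 0 0 = (G.submatrix Fin.succ Fin.succ).det := by
    rw [Matrix.adjugate_fin_succ_eq_det_submatrix, Fin.succAbove_zero]
    simp
  -- `adj(G) = adj(T')ᵀ adj(F) adj(T')`
  have hadjG : G.adjugate = T'.adjugateᵀ * (F.adjugate * T'.adjugate) := by
    rw [hG, Matrix.adjugate_mul_distrib, Matrix.adjugate_mul_distrib, ← Matrix.adjugate_transpose]
  -- the `(0,0)` entry of `Aᵀ (B A)` is the quadratic form of `B` at the `0`-th column of `A`
  have hentry : (T'.adjugateᵀ * (F.adjugate * T'.adjugate)) 0 0 =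
      (fun a => T'.adjugate a 0) ⬝ᵥ (F.adjugate *ᵥ fun a => T'.adjugate a 0) := by
    simp only [Matrix.mul_apply, Matrix.transpose_apply, dotProduct, Matrix.mulVec]
  -- `T' w' = μ e₀` over `ℝ[X]`
  have hT'w' : T' *ᵥ w' = C μ • (Pi.single 0 1 : Fin (n + 1) → ℝ[X]) := by
    funext i
    have h := RingHom.map_mulVec C T w i
    rw [hTw] at h
    change (T.map C *ᵥ (C ∘ w)) i = _
    rw [← h, Pi.smul_apply, Pi.smul_apply, smul_eq_mul, smul_eq_mul, map_mul]
    by_cases hi : i = 0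
    · subst hi
      simp
    · simp [hi]
  -- hence `det T' • w' = C μ • (0-th column of adj T')`
  have hcol : T'.det • w' = C μ • (fun a => T'.adjugate a 0) := by
    have h1 : T'.adjugate *ᵥ (T' *ᵥ w') = T'.det • w' := by
      rw [Matrix.mulVec_mulVec, Matrix.adjugate_mul, Matrix.smul_mulVec, Matrix.one_mulVec]
    rw [← h1, hT'w', Matrix.mulVec_smul, Matrix.mulVec_single_one]
    rfl
  have hdetT' : T'.det = C T.det := by
    rw [hT', RingHom.map_det, RingHom.mapMatrix_apply]
  -- assemble
  calc C (T.det ^ 2) * (w' ⬝ᵥ (F.adjugate *ᵥ w'))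
      = (T'.det • w') ⬝ᵥ (F.adjugate *ᵥ (T'.det • w')) := by
        rw [Matrix.mulVec_smul, dotProduct_smul, smul_dotProduct, smul_eq_mul, smul_eq_mul, hdetT',
          map_pow]
        ring
    _ = (C μ • fun a => T'.adjugate a 0) ⬝ᵥ (F.adjugate *ᵥ (C μ • fun a => T'.adjugate a 0)) := by
        rw [hcol]
    _ = C μ * (C μ * ((fun a => T'.adjugate a 0) ⬝ᵥ (F.adjugate *ᵥ fun a => T'.adjugate a 0))) := by
        rw [Matrix.mulVec_smul, dotProduct_smul, smul_dotProduct, smul_eq_mul, smul_eq_mul]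
    _ = C (μ ^ 2) * (∑ l, (X : ℝ[X]) ^ d l •
          ((T * S l * Tᵀ).submatrix Fin.succ Fin.succ).map C).det := by
        rw [← hentry, ← hadjG, hadj00, hGsub, map_pow]
        ring

/-! ## §3 The compression lemma -/

/-- **Compression lemma.**  For a lacunary pencil `F = ∑ₗ X^{dₗ} Sₗ` with real symmetric
`(n+1) × (n+1)` letters and a nonzero `w`, the polynomial `a = wᵀ adj(F) w` (the line's `compDet`)
is `C c · det (∑ₗ X^{dₗ} S'ₗ)` for a nonzero real `c` and real symmetric `n × n` letters `S'ₗ` —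
the compression of the pencil to the hyperplane `w^⊥` (`a = ‖w‖² det F|_{w^⊥}` in an orthonormal
frame; here any frame adapted to `w`, `c = (w·w)²/(det T)²`, `S'ₗ = (T Sₗ Tᵀ)` minus first row and
column). [folklore] -/
theorem compDet_eq_C_mul_det_pencil {n K : ℕ} (d : Fin K → ℕ)
    (S : Fin K → Matrix (Fin (n + 1)) (Fin (n + 1)) ℝ) (hS : ∀ l, (S l).IsSymm)
    (w : Fin (n + 1) → ℝ) (hw : w ≠ 0) :
    ∃ (c : ℝ) (S' : Fin K → Matrix (Fin n) (Fin n) ℝ), c ≠ 0 ∧ (∀ l, (S' l).IsSymm) ∧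
      (fun i => C (w i)) ⬝ᵥ ((∑ l, (X : ℝ[X]) ^ d l • (S l).map C).adjugate *ᵥ fun i => C (w i)) =
        C c * (∑ l, (X : ℝ[X]) ^ d l • (S' l).map C).det := by
  obtain ⟨T, hT, hTw⟩ := exists_frame w hw
  have hμ : w ⬝ᵥ w ≠ 0 := fun h => hw (dotProduct_self_eq_zero.mp h)
  have hTd2 : T.det ^ 2 ≠ 0 := pow_ne_zero 2 hT
  refine ⟨(T.det ^ 2)⁻¹ * (w ⬝ᵥ w) ^ 2, fun l => (T * S l * Tᵀ).submatrix Fin.succ Fin.succ,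
    mul_ne_zero (inv_ne_zero hTd2) (pow_ne_zero 2 hμ), fun l => ?_, ?_⟩
  · have h1 : (T * S l * Tᵀ).IsSymm := by
      unfold Matrix.IsSymm
      rw [Matrix.transpose_mul, Matrix.transpose_mul, Matrix.transpose_transpose, (hS l).eq,
        ← Matrix.mul_assoc]
    exact h1.submatrix _
  · have h := det_sq_mul_compDet_eq d S w T (w ⬝ᵥ w) hTw
    have key : (fun i => C (w i)) ⬝ᵥ
        ((∑ l, (X : ℝ[X]) ^ d l • (S l).map C).adjugate *ᵥ fun i => C (w i)) =
        C ((T.det ^ 2)⁻¹) * (C (T.det ^ 2) * ((fun i => C (w i)) ⬝ᵥ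
          ((∑ l, (X : ℝ[X]) ^ d l • (S l).map C).adjugate *ᵥ fun i => C (w i)))) := by
      rw [← mul_assoc, ← map_mul, inv_mul_cancel₀ hTd2, map_one, one_mul]
    rw [key, h, ← mul_assoc, ← map_mul]

end RolleSchur

end Summit.ValiantsHypothesis.ValiantsHypothesis.Theorems.LacunarySymmetroidMatrixDescartes
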